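import Summits.ResolutionOfSingularities.ResolutionOfSingularities.Theorems.EquisingularLiftEquisingularLiftNatResidueHypDefs6
import HarnessLib

/-!
# [OURS · L1 W4.5(b) · EL♮ / EL♮(3)] RESIDUE HYPOTHESIS DEFS 7 — ν2ʰ⁺ᴺ v2.2 «HOSTED NOSE + HOSTED CURVE ROUNDS» (WIDTH TABLE D4, row D4-1, desk R44):
# `NoseHypHostedNestBTriplePrime₂` and the inclusion `NoseHypPointsFirstBTriplePrime → NoseHypHostedNestBTriplePrime₂`

Typed by res-type-027 g20 (desk R44, 2026-08-28T19:32:37Z: «Defs6 v2 as a NEW MODULE with NEW decl names; ✓ p661159 stays in the tree as a banked sibling»).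
THE BODY of `NoseHypHostedNestBTriplePrime₂` IS the `hres` hypothesis block of res-L1-w45b-stub-2's K5ʰ v2.2 engine `target_elnat_of_hostedSubchainResolution₂`
(`…NatHostedSubchainPointResolution2`, source sha16 2a561901e166968f) VERBATIM, with the engine's parameters instantiated exactly as in …NatResidueHypDefs6: the initial
host `E₀` bound by `∃ E₀, (E₀ = ∅ ∨ E₀ = V₊(ℓ) for a non-zero linear form ℓ with H ⊄ V₊(ℓ)) ∧ …` and `ReachH := ReachHostedNoseBTriplePrime` (UNCHANGED, imported
from …NatResidueHypDefs6).  THE ONE DIFFERENCE from v2.1's blob: the stage-level HOSTED ROUND clause carries the CURVE CLAUSE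
`(∀ z : ↥(redSub F₁ Z hZ), IsClosed ({z} : Set ↥(redSub F₁ Z hZ)) → ringKrullDim ((redSub F₁ Z hZ).presheaf.stalk z) = ((1 : ℕ) : WithBot ℕ∞)) →`
(v2.1 quantified all closed `Z ⊆ closure E₁`, while the only supplier — ✓ p658608 + HT2 — covers curves; desk R44 (A)).  Since the v2.2 blob asks LESS
closure of a motive, `NoseHypHostedNestBTriplePrime → NoseHypHostedNestBTriplePrime₂` trivially, and the inclusion from (H-ν2) is re-proved verbatim
(`E₀ := ∅`; the round clause is never used).  House style R21″ (C); one definition + pure-logic lemmas; no `sorry`, no instance, no notation; standard axioms.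
OURS; NAMED HYPOTHESES, not statements of any manuscript; nothing of [Hironaka2017] is asserted; AI-written, weaker than expert review; resolution of
singularities in positive characteristic is NOT proved here (dimension 3 is Cossart–Piltant 2008/2009 in print).
`--kind definition --supports stmt-ResolutionOfSingularities-20148 --as helper`.
-/

set_option linter.dupNamespace false
noncomputable section
open CategoryTheory CategoryTheory.Limits AlgebraicGeometry TopologicalSpace Topology IsLocalRing
open Literature.AlgebraicGeometry.Resolution
open AlgebraicGeometry.Scheme.IdealSheafData
namespace Summit.ResolutionOfSingularities.ResolutionOfSingularities.Cruxes.EquisingularLiftNat.Sections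

/-- **`NoseHypHostedNestBTriplePrime₂ k n H ι`** (ν2ʰ⁺ᴺ v2.2, hosted CURVE rounds) — the K5ʰ v2.2 engine's `hres` hypothesis VERBATIM (source sha16 2a561901e166968f)
with `E₀` bound (`∅` or a hyperplane `V₊(ℓ)` not containing `H`) and `ReachH := ReachHostedNoseBTriplePrime`.  See the module docstring.
[OURS · L1 W4.5b · named hypothesis, no mathematical content of its own] -/
def NoseHypHostedNestBTriplePrime₂ (k : Type) [Field k] [IsAlgClosed k] (n : ℕ) (H : AlgebraicGeometry.Scheme.{0})
    (ι : H ⟶ (Literature.AlgebraicGeometry.Motives.projectiveSpace n k).left) : Prop :=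
  letI := MvPolynomial.gradedAlgebra (σ := Fin (n + 1)) (R := k)
  ∃ (E₀ : Set (Literature.AlgebraicGeometry.Motives.projectiveSpace n k).left),
    (E₀ = ∅ ∨ ∃ ℓ : MvPolynomial (Fin (n + 1)) k, ℓ.IsHomogeneous 1 ∧ ℓ ≠ 0 ∧
      ¬ (Set.range ι ⊆ {y : (Literature.AlgebraicGeometry.Motives.projectiveSpace n k).left |
        ℓ ∈ (y : ProjectiveSpectrum (MvPolynomial.homogeneousSubmodule (Fin (n + 1)) k)).asHomogeneousIdeal}) ∧
      E₀ = {y : (Literature.AlgebraicGeometry.Motives.projectiveSpace n k).left |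
        ℓ ∈ (y : ProjectiveSpectrum (MvPolynomial.homogeneousSubmodule (Fin (n + 1)) k)).asHomogeneousIdeal}) ∧
    (∃ (F' : AlgebraicGeometry.Scheme.{0}) (ρ' : F' ⟶ (Literature.AlgebraicGeometry.Motives.projectiveSpace n k).left) (T' : Set F'),
      (∀ Q : (∀ F₁ : AlgebraicGeometry.Scheme.{0}, (F₁ ⟶ (Literature.AlgebraicGeometry.Motives.projectiveSpace n k).left) → Set F₁ → Set F₁ → Prop),
        Q (Literature.AlgebraicGeometry.Motives.projectiveSpace n k).left (𝟙 (Literature.AlgebraicGeometry.Motives.projectiveSpace n k).left) (Set.range ι) E₀ →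
        (∀ (F₁ F₂ : AlgebraicGeometry.Scheme.{0}) (ρ : F₁ ⟶ (Literature.AlgebraicGeometry.Motives.projectiveSpace n k).left) (T₁ E₁ : Set F₁)
            (x : ↥((AlgebraicGeometry.Scheme.IdealSheafData.vanishingIdeal (⟨closure T₁, isClosed_closure⟩ : TopologicalSpace.Closeds F₁))).subscheme) (υ : F₂ ⟶ F₁) (hx : IsClosed ({(((AlgebraicGeometry.Scheme.IdealSheafData.vanishingIdeal (⟨closure T₁, isClosed_closure⟩ : TopologicalSpace.Closeds F₁))).subschemeι x : F₁)} : Set F₁)),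
          Q F₁ ρ T₁ E₁ → ¬ IsRegularLocalRing (((AlgebraicGeometry.Scheme.IdealSheafData.vanishingIdeal (⟨closure T₁, isClosed_closure⟩ : TopologicalSpace.Closeds F₁))).subscheme.presheaf.stalk x) →
          IsRegularLocalRing (F₁.presheaf.stalk (((AlgebraicGeometry.Scheme.IdealSheafData.vanishingIdeal (⟨closure T₁, isClosed_closure⟩ : TopologicalSpace.Closeds F₁))).subschemeι x : F₁)) →
          ((((AlgebraicGeometry.Scheme.IdealSheafData.vanishingIdeal (⟨closure T₁, isClosed_closure⟩ : TopologicalSpace.Closeds F₁))).subschemeι x : F₁) ∈ closure E₁ → ∀ e : ↥(redSub F₁ (closure E₁) isClosed_closure), (redSubι F₁ (closure E₁) isClosed_closure e : F₁) = (((AlgebraicGeometry.Scheme.IdealSheafData.vanishingIdeal (⟨closure T₁, isClosed_closure⟩ : TopologicalSpace.Closeds F₁))).subschemeι x : F₁) →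
          IsRegularLocalRing ((redSub F₁ (closure E₁) isClosed_closure).presheaf.stalk e)) → Literature.AlgebraicGeometry.Resolution.IsBlowup υ
            (AlgebraicGeometry.Scheme.IdealSheafData.vanishingIdeal (⟨{(((AlgebraicGeometry.Scheme.IdealSheafData.vanishingIdeal (⟨closure T₁, isClosed_closure⟩ : TopologicalSpace.Closeds F₁))).subschemeι x : F₁)}, hx⟩ : TopologicalSpace.Closeds F₁)) →
          Q F₂ (υ ≫ ρ) (closure (υ ⁻¹' (T₁ \ {(((AlgebraicGeometry.Scheme.IdealSheafData.vanishingIdeal (⟨closure T₁, isClosed_closure⟩ : TopologicalSpace.Closeds F₁))).subschemeι x : F₁)}))) (closure (υ ⁻¹' (E₁ \ {(((AlgebraicGeometry.Scheme.IdealSheafData.vanishingIdeal (⟨closure T₁, isClosed_closure⟩ : TopologicalSpace.Closeds F₁))).subschemeι x : F₁)})))) →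
        -- STAGE-LEVEL HOSTED ROUND at a regular curve `Z` inside the host, unobstructed IN THE HOST (in-host NEST lines and the nose curve alike)
        (∀ (F₁ F₃ : AlgebraicGeometry.Scheme.{0}) (ρ : F₁ ⟶ (Literature.AlgebraicGeometry.Motives.projectiveSpace n k).left) (T₁ E₁ : Set F₁) (Z : Set F₁) (hZ : IsClosed Z) (υ' : F₃ ⟶ F₁),
          Q F₁ ρ T₁ E₁ → Z ⊆ closure E₁ → Z ⊆ T₁ → ¬ T₁ ⊆ Z → (∀ z : ↥(redSub F₁ Z hZ), IsRegularLocalRing ((redSub F₁ Z hZ).presheaf.stalk z)) →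
          (∀ (i : redSub F₁ Z hZ ⟶ redSub F₁ (closure E₁) isClosed_closure), i ≫ redSubι F₁ (closure E₁) isClosed_closure = redSubι F₁ Z hZ →
            ∀ z : ↥(redSub F₁ Z hZ), IsRegularLocalRing ((redSub F₁ (closure E₁) isClosed_closure).presheaf.stalk (i z))) → DirStepUnobs F₁ (closure E₁) isClosed_closure Z hZ →
          (∀ z : ↥(redSub F₁ Z hZ), IsClosed ({z} : Set ↥(redSub F₁ Z hZ)) → ringKrullDim ((redSub F₁ Z hZ).presheaf.stalk z) = ((1 : ℕ) : WithBot ℕ∞)) →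
          Literature.AlgebraicGeometry.Resolution.IsBlowup υ' (AlgebraicGeometry.Scheme.IdealSheafData.vanishingIdeal (⟨Z, hZ⟩ : TopologicalSpace.Closeds F₁)) →
          Q F₃ (υ' ≫ ρ) (closure (υ' ⁻¹' (T₁ \ Z))) (closure (υ' ⁻¹' (closure E₁ \ Z)))) →
        (∀ (F₁ : AlgebraicGeometry.Scheme.{0}) (ρ : F₁ ⟶ (Literature.AlgebraicGeometry.Motives.projectiveSpace n k).left) (T₁ E₁ : Set F₁) (F₉ : AlgebraicGeometry.Scheme.{0}) (β : F₉ ⟶ F₁) (T₉ E₉ : Set F₉),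
          Q F₁ ρ T₁ E₁ → ReachHostedNoseBTriplePrime F₁ T₁ E₁ F₉ β T₉ E₉ → Q F₉ (β ≫ ρ) T₉ E₉) → ∃ E' : Set F', Q F' ρ' T' E') ∧
      Literature.AlgebraicGeometry.Resolution.Scheme.IsRegular (AlgebraicGeometry.Scheme.IdealSheafData.vanishingIdeal (⟨closure T', isClosed_closure⟩ : TopologicalSpace.Closeds F')).subscheme)

/-- v2.2 asks LESS closure of the motive than v2.1 (curve rounds only), so MORE motives qualify: the v2.2 blob implies the v2.1 blob
(✓ p661159's `NoseHypHostedNestBTriplePrime`). [OURS · pure logic] -/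
theorem noseHypHostedNestBTriplePrime_of_hostedNest₂ (k : Type) [Field k] [IsAlgClosed k] (n : ℕ) (H : AlgebraicGeometry.Scheme.{0})
    (ι : H ⟶ (Literature.AlgebraicGeometry.Motives.projectiveSpace n k).left) (h : NoseHypHostedNestBTriplePrime₂ k n H ι) :
    NoseHypHostedNestBTriplePrime k n H ι := by
  obtain ⟨E₀, hE₀, F', ρ', T', hQ, hreg⟩ := h
  refine ⟨E₀, hE₀, F', ρ', T', fun Q hQ0 hpt hround hreach => hQ Q hQ0 hpt ?_ hreach, hreg⟩
  intro F₁ F₃ ρ T₁ E₁ Z hZ υ' hQ1 hZE hZT hTZ hZreg hEreg hunobs _ hυ'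
  exact hround F₁ F₃ ρ T₁ E₁ Z hZ υ' hQ1 hZE hZT hTZ hZreg hEreg hunobs hυ'

/-- **BY INCLUSION** (the lemma the REPLACE cut `¬ NoseHypPointsFirstBTriplePrime ↦ ¬ NoseHypHostedNestBTriplePrime₂` needs): (H-ν2) implies ν2ʰ⁺ᴺ v2.2 —
`E₀ := ∅`, `Q₂ F ρ T := Q F ρ T ∅`, the proof of `noseHypHostedNestBTriplePrime_of_pointsFirst` VERBATIM (the round clause is never used).
[OURS · pure logic] -/
theorem noseHypHostedNestBTriplePrime₂_of_pointsFirst (k : Type) [Field k] [IsAlgClosed k] (n : ℕ) (H : AlgebraicGeometry.Scheme.{0})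
    (ι : H ⟶ (Literature.AlgebraicGeometry.Motives.projectiveSpace n k).left) (h : NoseHypPointsFirstBTriplePrime k n H ι) :
    NoseHypHostedNestBTriplePrime₂ k n H ι := by
  obtain ⟨F', ρ', T', hQ, hreg⟩ := h
  refine ⟨∅, Or.inl rfl, F', ρ', T', fun Q hQ0 hpt _ hreach => ⟨∅, ?_⟩, hreg⟩
  refine hQ (fun F ρ T => Q F ρ T ∅) hQ0 ?_
  intro F₁ F₂ ρ T₁ x υ hx hQ1 hnreg hreg1 hυ
  have hst : closure (υ ⁻¹' ((∅ : Set F₁) \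
      {((AlgebraicGeometry.Scheme.IdealSheafData.vanishingIdeal (⟨closure T₁, isClosed_closure⟩ : TopologicalSpace.Closeds F₁)).subschemeι x : F₁)})) =
      (∅ : Set F₂) := by
    rw [Set.empty_sdiff, Set.preimage_empty, closure_empty]
  have hpt' := hpt F₁ F₂ ρ T₁ ∅ x υ hx hQ1 hnreg hreg1 (fun hmem => absurd hmem (by rw [closure_empty]; exact Set.notMem_empty _)) hυ
  rw [hst] at hpt'
  refine ⟨hpt', fun F₉ β T₉ hR => ?_⟩
  have h9 := hreach F₂ (υ ≫ ρ) _ ∅ F₉ β T₉ ∅ hpt' (reachHostedNoseBTriplePrime_of_reachPtNose υ _ _ ∅ F₉ β T₉ hR)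
  simpa only [Category.assoc] using h9

/-- Contrapositive form, as the REPLACE cut consumes it: `¬ NoseHypHostedNestBTriplePrime₂ → ¬ NoseHypPointsFirstBTriplePrime`. [OURS · pure logic] -/
theorem not_noseHypPointsFirstBTriplePrime_of_not_hostedNest₂ (k : Type) [Field k] [IsAlgClosed k] (n : ℕ) (H : AlgebraicGeometry.Scheme.{0})
    (ι : H ⟶ (Literature.AlgebraicGeometry.Motives.projectiveSpace n k).left) (h : ¬ NoseHypHostedNestBTriplePrime₂ k n H ι) :
    ¬ NoseHypPointsFirstBTriplePrime k n H ι :=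
  fun h' => h (noseHypHostedNestBTriplePrime₂_of_pointsFirst k n H ι h')

end Summit.ResolutionOfSingularities.ResolutionOfSingularities.Cruxes.EquisingularLiftNat.Sections

end
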